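import Literature.Computability.Complexity.IWAmpCircuit
import Literature.Computability.Complexity.MildHardLanguage
import HarnessLib

/-!
# The strongly hard language of a mildly hard language (Impagliazzo–Wigderson amplification, the construction)

Given a language `L₁` (mildly hard on average in the application) this file defines the language
`L₂ = IWStrong.strongLang q L₁` whose slices are the Impagliazzo–Wigderson / Healy–Vadhan–Viola
amplification `Amp^f = f^{⊕k} ∘ (ND ⊕ Hit)` (`IWAmp.amp` of the tree) of the slices
`f = L₁ ∩ {0,1}ᴺ`, with ALL parameters driven by one natural number `q` (from the mild-hardness
exponent) and the scale `t`:

* `NOf q t = 2q t` (inner length), `bOf q = 2^{4q}` (alphabet of the design words), `dOf = N b`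
  (universe of the blocks = the `x`-part of the seed), `aOf = t + 6(⌊log₂ N⌋ + 1) + 3`, `kOf = 2^{aOf}`
  (EXPONENTIALLY many blocks, which is what makes the pairwise hitter reach advantage `2^{-t}`),
  `mOf = aOf + 1` (hitter index length; `idxOf` = the bits of the block number, `idxOf_injective`),
  `seedLen = d + (N + m) + N` (linear in `N` for fixed `q`);
* `sidx`, `parseSeed`, `encSeed_parseSeed`, `parseSeed_encSeed`, `encSeed_injective` — seeds as
  `seedLen` bits (a bijection with `IWAmpBridge.encSeed`);
* `strongFn q L₁ t` — `Amp` over the block family `IWAmpBridge.iwBlocks N b t k` (greedy design words,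
  agreements `≤ t`) and the Hankel hitter, read off `seedLen` bits; `scaleOf n` (the largest scale
  whose seed fits in `n` bits), `strongBit`, **`strongLang q L₁`** (the bit at the scale of the length,
  on the prefix), `sliceFn_strongLang`.

The hardness (`IWStrongHardness.lean`) and the `E`-machine are separate files.

## References

* R. Impagliazzo, A. Wigderson, *P = BPP if E requires exponential circuits: derandomizing the XOR
  lemma*, STOC 1997, Thm. 1 [ImpagliazzoWigderson1997].
* S. Hirahara, *NP-hardness of learning programs and partial MCSP*, ECCC TR22-119, Lemma 8.1 (the
  code `Amp`, formalised in `IWAmplification.lean`/`IWAmpHybrid.lean`) [Hirahara2022PartialMCSP].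
-/

noncomputable section

namespace Literature.Computability.Complexity

open Finset Filter MetaComplexity IWAmpBridge

namespace IWStrong

/-! ### Parameters, all driven by `q` (from the mild-hardness exponent) and the scale `t` -/

variable (q : ℕ)

/-- Inner input length `N = 2q t` (a multiple of `2q`, so that the greedy design words are
`NWMachine.designStrs (2q) (4q) t`). [folklore] -/
def NOf (t : ℕ) : ℕ := 2 * q * t
/-- Alphabet `b = 2^{4q}` of the design words. [folklore] -/
def bOf : ℕ := 2 ^ (4 * q)
/-- Universe `d = N b` of the block family (the `x`-part of the seed). [folklore] -/
def dOf (t : ℕ) : ℕ := NOf q t * bOf q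
/-- The block-count exponent `a₁ = t + 6 (⌊log₂ N⌋ + 1) + 3` (`k ε δ ≥ 6` with `ε = 2^{-t}`,
`δ = N^{-6}`). [folklore] -/
def aOf (t : ℕ) : ℕ := t + 6 * (Nat.log 2 (NOf q t) + 1) + 3
/-- Number of blocks `k = 2^{a₁}`. [folklore] -/
def kOf (t : ℕ) : ℕ := 2 ^ aOf q t
/-- Hitter index length `m = a₁ + 1` (so that `k < 2ᵐ`). [folklore] -/
def mOf (t : ℕ) : ℕ := aOf q t + 1
/-- Seed length `d + (N + m) + N`. [folklore] -/
def seedLen (t : ℕ) : ℕ := dOf q t + ((NOf q t + mOf q t) + NOf q t)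

/-- The hitter indexing: the bits of the block number. [folklore] -/
def idxOf (t : ℕ) (i : Fin (kOf q t)) (c : Fin (mOf q t)) : ZMod 2 := if (i : ℕ).testBit c then 1 else 0

/-- The indexing is injective (`k < 2ᵐ`). [folklore] -/
theorem idxOf_injective (t : ℕ) : Function.Injective (idxOf q t) := by
  intro i j h
  apply Fin.ext
  apply Nat.eq_of_testBit_eq
  intro c
  by_cases hc : c < mOf q t
  · have e1 := congrFun h ⟨c, hc⟩
    simp only [idxOf] at e1
    by_cases hi : (i : ℕ).testBit c <;> by_cases hj : (j : ℕ).testBit c <;> simp_all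
  · have hlt : ∀ l : Fin (kOf q t), (l : ℕ).testBit c = false := fun l =>
      Nat.testBit_lt_two_pow (lt_of_lt_of_le l.isLt (Nat.pow_le_pow_right (by norm_num) (by unfold mOf at hc; omega)))
    rw [hlt, hlt]

/-! ### Seeds as prefixes of the input -/

/-- The bit positions of a seed, in order: the `x`-part, then `t`, then `b`. [folklore] -/
def sidx (t : ℕ) : Fin (dOf q t) ⊕ HBits (NOf q t) (mOf q t) ≃ Fin (seedLen q t) :=
  (Equiv.sumCongr (Equiv.refl _) finSumFinEquiv).trans finSumFinEquiv

/-- A bit as an element of `𝔽₂`. [folklore] -/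
def bz (v : Bool) : ZMod 2 := if v then 1 else 0

/-- `bz v ≠ 0 ↔ v`. [folklore] -/
@[simp] theorem bz_ne_zero (v : Bool) : (bz v ≠ 0) = (v = true) := by cases v <;> simp [bz]

/-- Reading a seed off `seedLen` bits. [folklore] -/
def parseSeed (t : ℕ) (u : Fin (seedLen q t) → Bool) : IWAmp.Seed (NOf q t) (dOf q t) (mOf q t) :=
  (fun p => u (sidx q t (.inl p)),
    (fun c => bz (u (sidx q t (.inr (.inl c)))), fun r => bz (u (sidx q t (.inr (.inr r))))))

/-- The bits of a parsed seed are the bits read. [folklore] -/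
theorem encSeed_parseSeed (t : ℕ) (u : Fin (seedLen q t) → Bool) :
    encSeed (parseSeed q t u) = u ∘ sidx q t := by
  funext p
  rcases p with p | c | r <;> simp [encSeed, encHankel, parseSeed]

/-- Parsing the bits of a seed returns the seed. [folklore] -/
theorem parseSeed_encSeed (t : ℕ) (σ : IWAmp.Seed (NOf q t) (dOf q t) (mOf q t)) :
    parseSeed q t (encSeed σ ∘ (sidx q t).symm) = σ := by
  obtain ⟨x, tt, bb⟩ := σ
  simp only [parseSeed, Function.comp_apply, Equiv.symm_apply_apply, encSeed, encHankel, Sum.elim_inl, Sum.elim_inr]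
  refine Prod.ext rfl (Prod.ext ?_ ?_) <;> funext c <;> simp only [bz] <;>
    rcases (show (∀ z : ZMod 2, z = 0 ∨ z = 1) from by decide) (by first | exact tt c | exact bb c) with h | h <;> simp [h]

/-- `encSeed` is injective. [folklore] -/
theorem encSeed_injective (t : ℕ) : Function.Injective (encSeed (N := NOf q t) (d := dOf q t) (m := mOf q t)) := by
  intro σ σ' h
  rw [← parseSeed_encSeed q t σ, ← parseSeed_encSeed q t σ', h]

/-! ### The strong function and the strong language -/

variable (L₁ : Language Bool)

/-- **The strongly hard function at scale `t`**: `Amp` of the slice `L₁ ∩ {0,1}ᴺ` over the greedy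
block family and the Hankel hitter, read off a seed of `seedLen` bits (and `0` if the design words
are too few, which does not happen for large `t`). [cite: ImpagliazzoWigderson1997, Thm. 1] -/
def strongFn (t : ℕ) (u : Fin (seedLen q t) → Bool) : Bool :=
  if h : kOf q t ≤ (lexWords (NOf q t) (bOf q) t).length then
    IWAmp.amp (iwBlocks (NOf q t) (bOf q) t (kOf q t) h) (idxOf q t) (L₁.sliceFn (NOf q t)) (parseSeed q t u)
  else false

/-- `seedLen` is strictly monotone in the scale. [folklore] -/
theorem seedLen_strictMono (hq : 1 ≤ q) : StrictMono (seedLen q) := by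
  refine strictMono_nat_of_lt_succ fun t => ?_
  have hN : NOf q t < NOf q (t + 1) := by unfold NOf; nlinarith
  have ha : aOf q t ≤ aOf q (t + 1) := by
    unfold aOf
    have := Nat.log_mono_right (b := 2) hN.le
    omega
  unfold seedLen dOf mOf
  have hb : 1 ≤ bOf q := Nat.one_le_two_pow
  nlinarith

/-- `t ≤ seedLen t` (`q ≥ 1`). [folklore] -/
theorem le_seedLen (hq : 1 ≤ q) (t : ℕ) : t ≤ seedLen q t := by
  unfold seedLen NOf; nlinarith

/-- **The scale of a length**: the largest `t` with `seedLen t ≤ n`. [folklore] -/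
def scaleOf (n : ℕ) : ℕ := Nat.findGreatest (fun t => seedLen q t ≤ n) n

/-- Every scale is eventually reached. [folklore] -/
theorem le_scaleOf_of_le (hq : 1 ≤ q) {B n : ℕ} (h : seedLen q B ≤ n) : B ≤ scaleOf q n :=
  Nat.le_findGreatest ((le_seedLen q hq B).trans h) h

/-- The scale is maximal. [folklore] -/
theorem lt_seedLen_scaleOf_succ (hq : 1 ≤ q) (n : ℕ) : n < seedLen q (scaleOf q n + 1) := by
  by_contra h
  push Not at h
  exact Nat.findGreatest_is_greatest (Nat.lt_succ_self _) ((le_seedLen q hq _).trans h) h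

/-- **The strong bit of a string**: the strong function at the scale of its length, on the prefix. [folklore] -/
def strongBit (x : List Bool) : Bool :=
  if h : seedLen q (scaleOf q x.length) ≤ x.length then
    strongFn q L₁ (scaleOf q x.length) fun j => x.get (Fin.castLE h j)
  else false

/-- **The strongly hard language** `L₂` of `L₁`. [cite: ImpagliazzoWigderson1997, Thm. 1] -/
def strongLang : Language Bool := {x | strongBit q L₁ x = true}

/-- The slice of the strong language, as the strong function on the prefix. [folklore] -/
theorem sliceFn_strongLang {n t : ℕ} (ht : scaleOf q n = t) (h : seedLen q t ≤ n) (w : Fin n → Bool) :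
    (strongLang q L₁).sliceFn n w = strongFn q L₁ t fun j => w (Fin.castLE h j) := by
  have key : strongBit q L₁ (List.ofFn w) = strongFn q L₁ t fun j => w (Fin.castLE h j) := by
    unfold strongBit
    have hlen : (List.ofFn w).length = n := List.length_ofFn ..
    have h' : seedLen q (scaleOf q (List.ofFn w).length) ≤ (List.ofFn w).length := by rw [hlen, ht]; exact h
    rw [dif_pos h']
    -- transport along `hlen`/`ht`
    have : ∀ (n' : ℕ) (hn : (List.ofFn w).length = n') (t' : ℕ) (ht' : scaleOf q n' = t') (h1 : seedLen q (scaleOf q (List.ofFn w).length) ≤ (List.ofFn w).length)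
        (h2 : seedLen q t' ≤ n'),
        strongFn q L₁ (scaleOf q (List.ofFn w).length) (fun j => (List.ofFn w).get (Fin.castLE h1 j)) =
          strongFn q L₁ t' fun j => (List.ofFn w).get (Fin.castLE (h2.trans_eq hn.symm) j) := by
      intro n' hn t' ht' h1 h2
      subst hn; subst ht'; rfl
    rw [this n hlen t ht h' h]
    congr 1
    funext j
    simp [List.get_eq_getElem, Fin.castLE]
  unfold Language.sliceFn strongLang
  by_cases hb : strongBit q L₁ (List.ofFn w) = true
  · rw [(Set.mem_iff_boolIndicator _ _).1 (show List.ofFn w ∈ {x | strongBit q L₁ x = true} from hb), ← key, hb]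
  · rw [(Set.notMem_iff_boolIndicator _ _).1 (show List.ofFn w ∉ {x | strongBit q L₁ x = true} from hb), ← key]
    cases hs : strongBit q L₁ (List.ofFn w)
    · rfl
    · exact absurd hs hb

end IWStrong

end Literature.Computability.Complexity

end
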